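import Mathlib.GroupTheory.SpecificGroups.Cyclic
import Mathlib.NumberTheory.Padics.PadicVal.Basic
import Mathlib.Data.ZMod.QuotientGroup
import HarnessLib

/-!
# One scalar multiplication reads the `p`-part of an element's order in a finite abelian group:
# `(#G/p^j)·x = 0 ⟺ v_p(ord x) + j ≤ v_p #G`, and an element with `v_p(ord x) = v_p #G` makes the
# `p`-Sylow subgroup cyclic (`#G[p] ≤ p`) — pure group theory behind the `v_ℓ(P)` tests of C-16

HONEST FRAMING (cell `b2b-bsdres`, run/shared/lean/b2b/bsd-rank1-residual/, verbatim in every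
file): the goal of the cell is to DELETE the COMBINATION-SHAPED residual classes of the
Birch–Swinnerton-Dyer formula for ALL analytic-rank `≤ 1` elliptic curves over `ℚ` — "full BSD
formula for every rank `≤ 1` curve in class `C`" assembled STRICTLY from published theorems — so
that the rank-`≤ 1` remainder becomes exactly the CONSTRUCTION-SHAPED classes, which are TYPED
(missing-input `Prop`s), NOT attempted. This is not "finishing BSD". Seat `b2b-bsdres-additive-p3`
(typer-designate for the cell conjecture C-16, hyp R-16 (e)). THEOREMS ONLY about finite abelian groups
(Mathlib imports only); nothing about any curve is asserted, nothing is booked, no mark / label / count /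
tier moves; C-16 stays a CONJECTURE (data-suggested, never theorem). Sibling (the cyclic case of the
divisibility exponent): `Ordinary/CyclicSylowDivisibility.lean`. Consumer: `Ordinary/LocalDivExponentMultiplicationTest.lean`,
which reads these on `Ẽ(𝔽_ℓ)` to prove that the P-5 instruments' level-selection rule "`v_ℓ(P) = 0` iff
`(#Ẽ(𝔽_ℓ)/p)·P̄ ≠ O`" computes C-16's typed `localDivExponent W p ℓ P`
(`Ordinary/KuriharaExactOrderVocabulary.lean`; hyp `SHARPENED-CONJECTURES.md` §120 C120.1; additive-p3
`R1-DEPTH-LAW.md` §1, §4 (a)) and that such a level is automatically cyclic.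

## What is proved (`G` finite abelian, `p` prime, `e = v_p #G`)

* §1: `(#G/p^j) • x = 0 ⟺ v_p(ord x) + j ≤ e` for `j ≤ e` (write `#G = p^e m`, `ord x = p^v b` with
  `p ∤ m, b` and `b ∣ m`); hence `(#G/p) • x ≠ 0 ⟺ v_p(ord x) = e` when `e ≥ 1`; the `p`-primary
  component `(#G/p^e) • x` has order EXACTLY `p^{v_p(ord x)}`. No cyclicity needed.
* §2: if some `x` has `v_p(ord x) = e` then `#G[p] ≤ p` (the `p`-Sylow subgroup is cyclic, generated by
  the `p`-primary component of `x`): every `y ∈ G[p]` maps to an element of `G/⟨w⟩` (`w` the primary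
  component, `#⟨w⟩ = p^e`, `p ∤ #(G/⟨w⟩)`) of order dividing `gcd(p, #(G/⟨w⟩)) = 1`, so `G[p] ⊆ ⟨w⟩`, and
  a cyclic group has at most `p` elements killed by `p`. So ONE multiplication `(#G/p) • x ≠ 0` certifies
  both "`x` generates the `p`-Sylow up to its prime-to-`p` part" and "`#G[p] ≤ p`".

References: standard (finite abelian groups); J. H. Silverman, AEC 2nd ed. (2009), VII.2–VII.3 for the use
on `Ẽ(𝔽_ℓ)` [SilvermanAEC2009].
-/

noncomputable section

open scoped Classical

namespace Summit.BirchSwinnertonDyer.Rank1Residual.Ordinary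

/-! ### §1 The one-multiplication test for the `p`-part of the order -/

section Group

variable {G : Type*} [AddCommGroup G] [Finite G] {p : ℕ} [hp : Fact p.Prime]

/-- `v_p(ord x) ≤ v_p #G` (`ord x ∣ #G`). [folklore] -/
theorem padicValNat_addOrderOf_le_padicValNat_card (x : G) :
    padicValNat p (addOrderOf x) ≤ padicValNat p (Nat.card G) := by
  have hn0 : Nat.card G ≠ 0 := Nat.card_pos.ne'
  rw [← padicValNat_dvd_iff_le hn0]
  exact pow_padicValNat_dvd.trans (addOrderOf_dvd_natCard x)

/-- `n = p^{v_p n} · m` with `p ∤ m` (`n ≠ 0`). [folklore] -/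
private theorem exists_eq_pow_padicValNat_mul_not_dvd {n : ℕ} (hn : n ≠ 0) :
    ∃ m : ℕ, n = p ^ padicValNat p n * m ∧ ¬ p ∣ m ∧ m ≠ 0 := by
  set e := padicValNat p n with he
  obtain ⟨m, hm⟩ : p ^ e ∣ n := pow_padicValNat_dvd
  refine ⟨m, hm, fun hpm => ?_, ?_⟩
  · have hdiv : p ^ (e + 1) ∣ n := by
      rw [hm, pow_succ]
      exact mul_dvd_mul_left _ hpm
    rw [he] at hdiv
    exact pow_succ_padicValNat_not_dvd hn hdiv
  · rintro rfl
    exact hn (by rw [hm, mul_zero])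

/-- **`(#G / p^j) • x = 0 ⟺ v_p(ord x) + j ≤ e`** for `j ≤ e = v_p #G`. With `#G = p^e m` (`p ∤ m`) and
`ord x = p^v b` (`p ∤ b`, so `b ∣ m`): `(p^{e−j} m) • x = 0 ⟺ p^v b ∣ p^{e−j} m ⟺ v ≤ e − j`. No
cyclicity is needed. [folklore] -/
theorem card_div_pow_smul_eq_zero_iff {j : ℕ} (hj : j ≤ padicValNat p (Nat.card G)) (x : G) :
    (Nat.card G / p ^ j) • x = 0 ↔
      padicValNat p (addOrderOf x) + j ≤ padicValNat p (Nat.card G) := by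
  have hpp : p.Prime := hp.out
  set n := Nat.card G with hn
  set e := padicValNat p n with he
  have hn0 : n ≠ 0 := Nat.card_pos.ne'
  obtain ⟨m, hm, hpm, hm0⟩ := exists_eq_pow_padicValNat_mul_not_dvd (p := p) hn0
  rw [← he] at hm
  -- `n / p^j = p^(e - j) * m`
  have hpow : p ^ e = p ^ j * p ^ (e - j) := by rw [← pow_add, Nat.add_sub_cancel' hj]
  have hnj : n / p ^ j = p ^ (e - j) * m := by
    rw [hm, hpow, mul_assoc, Nat.mul_div_cancel_left _ (pow_pos hpp.pos j)]
  -- `ord x = p^v * b`, `p ∤ b`, `b ∣ m`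
  set d := addOrderOf x with hd
  have hd0 : d ≠ 0 := (addOrderOf_pos x).ne'
  have hdn : d ∣ n := addOrderOf_dvd_natCard x
  obtain ⟨b, hb, hpb, hb0⟩ := exists_eq_pow_padicValNat_mul_not_dvd (p := p) hd0
  set v := padicValNat p d with hv
  have hbm : b ∣ m := by
    have hbcop : Nat.Coprime b (p ^ e) :=
      Nat.Coprime.pow_right _ ((Nat.Prime.coprime_iff_not_dvd hpp).mpr hpb).symm
    have h1 : b ∣ p ^ e * m := by
      rw [← hm]
      exact (Dvd.intro_left (p ^ v) hb.symm).trans hdn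
    exact hbcop.dvd_of_dvd_mul_left h1
  rw [← addOrderOf_dvd_iff_nsmul_eq_zero, hnj, ← hd]
  constructor
  · intro h
    have h1 : p ^ v ∣ p ^ (e - j) * m := (Dvd.intro b hb.symm).trans h
    have hne : p ^ (e - j) * m ≠ 0 := mul_ne_zero (pow_ne_zero _ hpp.ne_zero) hm0
    have h2 : v ≤ padicValNat p (p ^ (e - j) * m) := (padicValNat_dvd_iff_le hne).mp h1
    rw [padicValNat.mul (pow_ne_zero _ hpp.ne_zero) hm0, padicValNat.prime_pow,
      padicValNat.eq_zero_of_not_dvd hpm, add_zero] at h2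
    omega
  · intro h
    rw [hb]
    exact mul_dvd_mul (pow_dvd_pow p (by omega)) hbm

/-- **`(#G / p) • x ≠ 0 ⟺ v_p(ord x) = v_p #G`** when `p ∣ #G`: ONE scalar multiplication decides
whether the `p`-primary component of `x` has the full `p`-exponent of `G` (then it generates a cyclic
`p`-Sylow subgroup, §2). [folklore] -/
theorem card_div_smul_ne_zero_iff (he : 1 ≤ padicValNat p (Nat.card G)) (x : G) :
    (Nat.card G / p) • x ≠ 0 ↔ padicValNat p (addOrderOf x) = padicValNat p (Nat.card G) := by
  have h := card_div_pow_smul_eq_zero_iff (p := p) (j := 1) he x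
  rw [pow_one] at h
  rw [Ne, h]
  have := padicValNat_addOrderOf_le_padicValNat_card (p := p) x
  omega

/-- **The `p`-primary component `(#G / p^e) • x` (`e = v_p #G`) has order EXACTLY `p^{v_p(ord x)}`**:
with `#G = p^e m`, `ord x = p^v b`, `p ∤ m`, `b ∣ m`: `ord(m • x) = p^v b / gcd(p^v b, m) = p^v`. (The
instruments' `Q = (#Ẽ(𝔽_ℓ)/p^{e_ℓ})·P̄`, `ord Q = p^t`, `v_ℓ(P) = e_ℓ − t`.) [folklore] -/
theorem addOrderOf_card_div_pow_smul (x : G) :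
    addOrderOf ((Nat.card G / p ^ padicValNat p (Nat.card G)) • x) =
      p ^ padicValNat p (addOrderOf x) := by
  have hpp : p.Prime := hp.out
  set n := Nat.card G with hn
  set e := padicValNat p n with he
  have hn0 : n ≠ 0 := Nat.card_pos.ne'
  obtain ⟨m, hm, hpm, hm0⟩ := exists_eq_pow_padicValNat_mul_not_dvd (p := p) hn0
  rw [← he] at hm
  have hq : n / p ^ e = m := by rw [hm, Nat.mul_div_cancel_left _ (pow_pos hpp.pos e)]
  set d := addOrderOf x with hd
  have hd0 : d ≠ 0 := (addOrderOf_pos x).ne'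
  have hdn : d ∣ n := addOrderOf_dvd_natCard x
  obtain ⟨b, hb, hpb, hb0⟩ := exists_eq_pow_padicValNat_mul_not_dvd (p := p) hd0
  set v := padicValNat p d with hv
  have hbm : b ∣ m := by
    have hbcop : Nat.Coprime b (p ^ e) :=
      Nat.Coprime.pow_right _ ((Nat.Prime.coprime_iff_not_dvd hpp).mpr hpb).symm
    have h1 : b ∣ p ^ e * m := by
      rw [← hm]
      exact (Dvd.intro_left (p ^ v) hb.symm).trans hdn
    exact hbcop.dvd_of_dvd_mul_left h1
  have hcop : Nat.Coprime (p ^ v) m :=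
    Nat.Coprime.pow_left _ ((Nat.Prime.coprime_iff_not_dvd hpp).mpr hpm)
  rw [hq, addOrderOf_nsmul' x hm0, ← hd, hb, Nat.Coprime.gcd_mul_left_cancel b hcop,
    Nat.gcd_eq_left hbm, Nat.mul_div_cancel _ (Nat.pos_of_ne_zero hb0)]

/-- Hence `v_p(ord((#G / p^e) • x)) = v_p(ord x)`. [folklore] -/
theorem padicValNat_addOrderOf_card_div_pow_smul (x : G) :
    padicValNat p (addOrderOf ((Nat.card G / p ^ padicValNat p (Nat.card G)) • x)) =
      padicValNat p (addOrderOf x) := by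
  rw [addOrderOf_card_div_pow_smul, padicValNat.prime_pow]

end Group

/-! ### §2 One element of full `p`-exponent makes the `p`-Sylow subgroup cyclic: `#G[p] ≤ p` -/

section Cyclic

variable {G : Type*} [AddCommGroup G] [Finite G] {p : ℕ} [hp : Fact p.Prime]

/-- **If `v_p(ord x) = v_p #G` for some `x`, then `#G[p] ≤ p`.** Let `w = (#G/p^e) • x`, of order `p^e`
(§1), `H = ℤ·w`. For `y` with `p • y = 0`, the class of `y` in `G/H` (a group of order `#G/p^e`, prime to
`p`) has order dividing `p` and dividing `#(G/H)`, hence is trivial: `G[p] ⊆ H`; and the cyclic group `H`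
has at most `p` elements killed by `p` (Mathlib `IsAddCyclic.card_nsmul_eq_zero_le`). [folklore] -/
theorem card_torsion_le_of_padicValNat_addOrderOf_eq {x : G}
    (hx : padicValNat p (addOrderOf x) = padicValNat p (Nat.card G)) :
    Nat.card {y : G // p • y = 0} ≤ p := by
  have hpp : p.Prime := hp.out
  have hn0 : Nat.card G ≠ 0 := Nat.card_pos.ne'
  set e := padicValNat p (Nat.card G) with he
  set w := (Nat.card G / p ^ e) • x with hwdef
  have hw : addOrderOf w = p ^ e := by
    rw [hwdef, he, addOrderOf_card_div_pow_smul, hx]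
  set H := AddSubgroup.zmultiples w with hH
  have hcardH : Nat.card H = p ^ e := by rw [hH, Nat.card_zmultiples, hw]
  -- `p ∤ #(G/H)`
  have hquot : Nat.card (G ⧸ H) * Nat.card H = Nat.card G :=
    (H.card_eq_card_quotient_mul_card_addSubgroup).symm
  have hm : ¬ p ∣ Nat.card (G ⧸ H) := by
    intro hdvd
    have hdiv : p ^ (e + 1) ∣ Nat.card G := by
      rw [← hquot, hcardH, pow_succ, mul_comm (p ^ e) p]
      exact mul_dvd_mul_right hdvd _
    rw [he] at hdiv
    exact pow_succ_padicValNat_not_dvd hn0 hdiv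
  -- `G[p] ⊆ H`
  have key : ∀ y : G, p • y = 0 → y ∈ H := by
    intro y hy
    have h1 : addOrderOf (QuotientAddGroup.mk y : G ⧸ H) ∣ p :=
      addOrderOf_dvd_of_nsmul_eq_zero (by rw [← QuotientAddGroup.mk_nsmul, hy, QuotientAddGroup.mk_zero])
    have h2 : addOrderOf (QuotientAddGroup.mk y : G ⧸ H) ∣ Nat.card (G ⧸ H) := addOrderOf_dvd_natCard _
    have hord1 : addOrderOf (QuotientAddGroup.mk y : G ⧸ H) = 1 := by
      rcases (Nat.dvd_prime hpp).mp h1 with h | h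
      · exact h
      · exact absurd (h ▸ h2) hm
    exact (QuotientAddGroup.eq_zero_iff y).mp (AddMonoid.addOrderOf_eq_one_iff.mp hord1)
  -- count inside the cyclic group `H`
  haveI : Fintype H := Fintype.ofFinite H
  let f : {y : G // p • y = 0} → {h : H // p • h = 0} := fun y =>
    ⟨⟨y.1, key y.1 y.2⟩, Subtype.ext (by
      change p • (y.1 : G) = ((0 : H) : G)
      rw [y.2, AddSubgroup.coe_zero])⟩
  have hf : Function.Injective f := by
    intro a b h
    have h' := congrArg (fun z : {h : H // p • h = 0} => ((z.1 : H) : G)) h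
    exact Subtype.ext h'
  calc Nat.card {y : G // p • y = 0} ≤ Nat.card {h : H // p • h = 0} :=
        Nat.card_le_card_of_injective f hf
    _ = (Finset.univ.filter fun h : H => p • h = 0).card := by
        rw [Nat.card_eq_fintype_card, Fintype.card_subtype]
    _ ≤ p := IsAddCyclic.card_nsmul_eq_zero_le hpp.pos

/-- **One multiplication certifies cyclicity: `(#G / p) • x ≠ 0 ⟹ #G[p] ≤ p`** (`p ∣ #G`).
[folklore] -/
theorem card_torsion_le_of_card_div_smul_ne_zero (he : 1 ≤ padicValNat p (Nat.card G)) {x : G}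
    (hx : (Nat.card G / p) • x ≠ 0) : Nat.card {y : G // p • y = 0} ≤ p :=
  card_torsion_le_of_padicValNat_addOrderOf_eq ((card_div_smul_ne_zero_iff he x).mp hx)

end Cyclic

end Summit.BirchSwinnertonDyer.Rank1Residual.Ordinary

end
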